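import Literature.AnabelianGeometry.AbsoluteAnabelian.MonoidKummerMaps
import Literature.AnabelianGeometry.AbsoluteAnabelian.MLFGaloisCategories
import Literature.AnabelianGeometry.AbsoluteAnabelian.DiagramMorphisms
import Mathlib.CategoryTheory.Endomorphism

/-!
# [AbsTopIII] Proposition 3.2 — statements-first SUB-DAG of the printed proof/constructions
# (intermediate statements; companion of `MonoidKummerMaps.lean`)

S. Mochizuki, *Topics in absolute anabelian geometry III*, §3, Proposition 3.2 (i)–(v) pp. 71–72, its
proof p. 72 l.43 – p. 73 l.4 and Remarks 3.2.1–3.2.2 p. 73 (bib key `MochizukiAbsTopIII2015`; locators =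
kurims manuscript pages, lit key `paper:url-5493eb38cbb7`), with the AUTHOR'S ERRATUM «Comments on
[AbsTopIII]» (June 2019) item (5) on (iv) in force. abc-iut cell, HUMAN RULING D-0068 (1)
(«decompose recursively, statements-first») / director 2026-08-25T23:59:05Z queue (1); plan file
`plan/L4/SUBDAG-AbsTopIII-Prop32.md` (rows `P32.*`), seat abc-iut-w4-d045 over abc-iut-L4-t2's
`MonoidKummerMaps.lean` (the typed statement of record: Prop 3.2 (i)–(iii) = OUTPUT FIELDS of
`MonoidKummerTheory`, (iv) = `PairIsoDeterminedByGalois` / `GaloisIsoLiftsToTMPairIso` / `AutPairCenterFree`,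
(v) = `MonoidKummerTheory.RecoversClosure`). Nothing of L4-t2's file is restated; this file ADDS the
intermediate statements of the printed argument that have no decl yet:

* rows P32.i.L01–L06 — the CONSTRUCTION of (i) «by composing the natural isomorphism [of Brauer groups]
  `H²(G, μ_{ℚ/ℤ}(M_TM)) ⥲ H²(G, M^gp_TM)` with the inverse of … `H²(G^unr, (M^unr_TM)^gp) ⥲ H²(G, M^gp_TM)`
  followed by `H²(G^unr,(M^unr_TM)^gp) ⥲ H²(G^unr,(M^unr_TM)^gp/(M^unr_TM)^×) ⥲ H²(Ẑ, ℤ) ⥲ ℚ/ℤ` … and then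
  applying the functor `Hom(ℚ/ℤ, −)`» — as the DATA structure `Prop32iChain T` (the five printed
  isomorphisms over their printed carriers; the tree has no `H²` with coefficients `M^gp`, `μ_{ℚ/ℤ}`,
  `(M^unr)^gp`, so the carriers are abstract, exactly as `ContCohomologyData` treats `H²(G, μ_Ẑ(M))`),
  its composite `h2IsoOfChain`, and the statement `Prop32iChain.H2IsoEq` «the output `h2Iso` IS this
  composite»; the MODEL anchor at finite level is the tree's PROVED `mlf_H2_mu_equiv_zmod`
  (`LocalClassFieldTheoryForms`, abc-iut-L4-d3);
* row P32.i.L07 — the FUNCTORIALITY of (i) with the index factor of Rmk 3.2.2 («dividing the `Ẑ` … by a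
  factor given by the index of the image of the induced open homomorphism on arithmetic Galois groups»):
  `H2Pullback`, `Prop32i_indexCompat`;
* row P32.iv.L16 — SURJECTIVITY of (iv) for pairs OF STRICTLY BELYI TYPE (`T ∈ {TM, TF}`, via (iii)):
  `GaloisIsoLiftsToTMPairIsoOfStrictlyBelyi`, `GaloisIsoLiftsToTFPairIsoOfStrictlyBelyi` (schemas over
  the hypothesis predicate, exactly as L4-t2's `GaloisIsoLiftsToTMPairIso` is over `IsOfHypOrbicurveType`);
* row P32.iv.L17 — ID-RIGIDITY «the categories … `𝒞^{MLF-hyp}_T`, `𝒞^{MLF-sB}_T` are id-rigid [cf. §0]»: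
  `Prop32iv_idRigid` (over the tree's `IsIdRigid` and the full subcategory of `MLFGaloisMonoidPairCat T`
  cut out by a hypothesis predicate) + the printed REDUCTION «centre-free automorphism groups ⇒
  id-rigid» PROVED here in general (`isIdRigid_of_aut_center_trivial`, pure category theory).

Rows already carried by the tree (not re-typed): (ii) Kummer maps / limit (`MonoidKummerTheory.kummer…`,
model `ModelMLFGaloisData.kummerTheory`, p409840), (iii) `addStr`, Rmk 3.2.1 `cycIso`, (iv) injectivity
PROVED `pairIsoDeterminedByGalois_holds`, centre-freeness PROVED modulo slimness
`autPairCenterFree_of_isSlimGroup`, surjectivity (orbicurve form) `GaloisIsoLiftsToTMPairIso`, (v) object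
level `RecoversClosure` (model PROVED). Rows recorded in the plan file only (vocabulary owned elsewhere):
L08/L11 junctions with Cor 1.10 (a)(c) cyclotomes (abc-iut-L4-t1), L15a/b LCFT transport (v2 of this
file after L4-t2's word), L18 the abstract log-Frobenius functors of (v) (abc-iut-L4-t2).

HONEST FRAMING: definitions and `Prop`-valued statements quoting a refereed 2015 paper; the one theorem
is elementary category theory; nothing is asserted about the paper's claims; nothing here bears on
[IUTchIII] Cor. 3.12; typed ≠ proved.
-/

namespace Literature.AnabelianGeometry.AbsoluteAnabelian

open _root_.CategoryTheory

universe v u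

noncomputable section

/-! ### Prop 3.2 (i): the Brauer-group chain (plan rows P32.i.L01–L06) -/

/-- `ℚ/ℤ` (Mathlib `AddCircle (1 : ℚ)`, as in `IsTorsionCyclotomic`), lifted to the ambient universe —
the printed target of «`H²(G, μ_{ℚ/ℤ}(M_TM)) ⥲ ℚ/ℤ`». [cite: MochizukiAbsTopIII2015, Proposition 3.2 (i) p.71] -/
abbrev QmodZ : Type u := ULift.{u} (AddCircle (1 : ℚ))

/-- **Prop 3.2 (i), the printed CONSTRUCTION as data** (p. 71 l.22–60), over a Kummer theory `T` of an
MLF-Galois pair `(Π ↷ M)` with arithmetic Galois group `G`: the carriers `H²(G, μ_{ℚ/ℤ}(M_TM))`,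
`H²(G, M^gp_TM)` [«`gp` denotes the groupification of a monoid»], `H²(G^unr, (M^unr_TM)^gp)` [«`M^unr_TM ⊆ M_TM`
denotes the submonoid of elements fixed by the kernel of the quotient `G ↠ G^unr` of Corollary 1.10, (b)»],
`H²(G^unr, (M^unr_TM)^gp/(M^unr_TM)^×)`, `H²(Ẑ, ℤ)` as abstract additive groups (continuous `H²` with these
coefficients is not in the tree — cf. `ContCohomologyData`), and the five printed natural isomorphisms:
`brauerKummer` «the natural isomorphism [of Brauer groups] `H²(G, μ_{ℚ/ℤ}(M_TM)) ⥲ H²(G, M^gp_TM)`» (l.22–26);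
`inflUnr` «the natural isomorphism [of Brauer groups] `H²(G^unr,(M^unr_TM)^gp) ⥲ H²(G, M^gp_TM)`» (l.27–33);
`unitsAcyclic` «`H²(G^unr,(M^unr_TM)^gp) ⥲ H²(G^unr,(M^unr_TM)^gp/(M^unr_TM)^×)`» (l.36–43); `valGen` «`⥲ H²(Ẑ, ℤ)`»
[«the isomorphism `(M^unr_TM)^gp/(M^unr_TM)^× ⥲ ℤ` is obtained by considering a generator of the monoid
`M^unr_TM/(M^unr_TM)^× ≅ ℕ`; we apply the isomorphism `G^unr ⥲ Ẑ` of Corollary 1.10, (b)»] (l.43–57); `toQmodZ`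
«`⥲ ℚ/ℤ`» (l.45–47); and the two identifications used by «applying the functor `Hom(ℚ/ℤ, −)`» (l.57):
`homQmodZ : Hom(ℚ/ℤ, H²(G, μ_{ℚ/ℤ}(M_TM))) ≅ H²(G, μ_Ẑ(M_TM))` (the `H²` slot of `T`) and `endQmodZ : End(ℚ/ℤ) ≅ Ẑ`.
Inputs: [AbsAnab] Prop 1.2.1 (vii) («the arguments given in the proof of»), Cor 1.10 (b).
[cite: MochizukiAbsTopIII2015, Proposition 3.2 (i) p.71] -/
structure Prop32iChain {P : GaloisMonoidPair.{u}} (T : MonoidKummerTheory P) : Type (u + 1) where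
  /-- `H²(G, μ_{ℚ/ℤ}(M_TM))` -/
  H2muQZ : Type u
  [grpH2muQZ : AddCommGroup H2muQZ]
  /-- `H²(G, M^gp_TM)` («Brauer group») -/
  H2Mgp : Type u
  [grpH2Mgp : AddCommGroup H2Mgp]
  /-- row L01: `H²(G, μ_{ℚ/ℤ}(M_TM)) ⥲ H²(G, M^gp_TM)` -/
  brauerKummer : H2muQZ ≃+ H2Mgp
  /-- `H²(G^unr, (M^unr_TM)^gp)` -/
  H2unr : Type u
  [grpH2unr : AddCommGroup H2unr]
  /-- row L02: `H²(G^unr,(M^unr_TM)^gp) ⥲ H²(G, M^gp_TM)` -/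
  inflUnr : H2unr ≃+ H2Mgp
  /-- `H²(G^unr, (M^unr_TM)^gp/(M^unr_TM)^×)` -/
  H2unrVal : Type u
  [grpH2unrVal : AddCommGroup H2unrVal]
  /-- row L03: `H²(G^unr,(M^unr_TM)^gp) ⥲ H²(G^unr,(M^unr_TM)^gp/(M^unr_TM)^×)` -/
  unitsAcyclic : H2unr ≃+ H2unrVal
  /-- `H²(Ẑ, ℤ)` -/
  H2ZhatZ : Type u
  [grpH2ZhatZ : AddCommGroup H2ZhatZ]
  /-- row L04: `H²(G^unr,(M^unr_TM)^gp/(M^unr_TM)^×) ⥲ H²(Ẑ, ℤ)` (generator of `M^unr/(M^unr)^× ≅ ℕ`;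
  `G^unr ⥲ Ẑ` of Cor 1.10 (b)) -/
  valGen : H2unrVal ≃+ H2ZhatZ
  /-- row L05: `H²(Ẑ, ℤ) ⥲ ℚ/ℤ` -/
  toQmodZ : H2ZhatZ ≃+ QmodZ.{u}
  /-- row L06 (first half): `Hom(ℚ/ℤ, H²(G, μ_{ℚ/ℤ}(M_TM))) ≅ H²(G, μ_Ẑ(M_TM))`, the `H²` slot of `T` -/
  homQmodZ : (QmodZ.{u} →+ H2muQZ) ≃+ T.coh.H2
  /-- row L06 (second half): `Hom(ℚ/ℤ, ℚ/ℤ) ≅ Ẑ` -/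
  endQmodZ : (QmodZ.{u} →+ QmodZ.{u}) ≃+ ZhatAdd.{u}

attribute [instance] Prop32iChain.grpH2muQZ Prop32iChain.grpH2Mgp Prop32iChain.grpH2unr
  Prop32iChain.grpH2unrVal Prop32iChain.grpH2ZhatZ

namespace Prop32iChain

variable {P : GaloisMonoidPair.{u}} {T : MonoidKummerTheory P} (C : Prop32iChain T)

/-- «the resulting isomorphism `H²(G, μ_{ℚ/ℤ}(M_TM)) ⥲ ℚ/ℤ`» (p. 71 l.57–60): the composite of rows
L01, L02⁻¹, L03, L04, L05 (DEFINED). [cite: MochizukiAbsTopIII2015, Proposition 3.2 (i) p.71] -/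
def invariant : C.H2muQZ ≃+ QmodZ.{u} :=
  C.brauerKummer.trans (C.inflUnr.symm.trans (C.unitsAcyclic.trans (C.valGen.trans C.toQmodZ)))

/-- «applying the functor `Hom(ℚ/ℤ, −)`» to `invariant` (p. 71 l.57): post-composition,
`Hom(ℚ/ℤ, H²(G, μ_{ℚ/ℤ}(M_TM))) ≅ Hom(ℚ/ℤ, ℚ/ℤ)` (DEFINED). [cite: MochizukiAbsTopIII2015, Proposition 3.2 (i) p.71] -/
def homInvariant : (QmodZ.{u} →+ C.H2muQZ) ≃+ (QmodZ.{u} →+ QmodZ.{u}) where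
  toFun f := C.invariant.toAddMonoidHom.comp f
  invFun g := C.invariant.symm.toAddMonoidHom.comp g
  left_inv f := by ext x; simp
  right_inv g := by ext x; simp
  map_add' f g := by ext x; simp

/-- «the natural isomorphism `H²(G, μ_Ẑ(M_TM)) ⥲ Ẑ`» ASSEMBLED from the chain (p. 71 l.18–21, 57–60):
`H²(G, μ_Ẑ(M)) ≅ Hom(ℚ/ℤ, H²(G, μ_{ℚ/ℤ}(M))) ≅ Hom(ℚ/ℤ, ℚ/ℤ) ≅ Ẑ` (DEFINED).
[cite: MochizukiAbsTopIII2015, Proposition 3.2 (i) p.71] -/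
def h2IsoOfChain : T.coh.H2 ≃+ ZhatAdd.{u} :=
  C.homQmodZ.symm.trans (C.homInvariant.trans C.endQmodZ)

/-- **Row P32.i.L06 (statement)**: the output `h2Iso` of the Kummer theory `T` IS the isomorphism
constructed by the printed chain. Named `Prop` on the data; not asserted.
[cite: MochizukiAbsTopIII2015, Proposition 3.2 (i) p.71] -/
def H2IsoEq : Prop := T.h2Iso = C.h2IsoOfChain

end Prop32iChain

/-! ### Prop 3.2 (i), functoriality with the index factor (Rmk 3.2.2; plan row P32.i.L07) -/

/-- The `H²`-pull-back along a morphism of pairs `φ : (Π ↷ M) → (Π* ↷ M*)` (Def 3.1 (ii): `φ_Π` induces an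
OPEN INJECTIVE homomorphism of arithmetic Galois groups `G ↪ G*`): the induced map
`H²(G*, μ_Ẑ(M*)) → H²(G, μ_Ẑ(M))` (restriction to the image of `G` composed with the coefficient map
`μ_Ẑ(M*) → μ_Ẑ(M)`) together with «the index of the image of the induced open homomorphism on arithmetic
Galois groups» (Rmk 3.2.2). Carried as data: `ContCohomologyData` records no functoriality of its `H²` slot.
[cite: MochizukiAbsTopIII2015, Remark 3.2.2 p.73] -/
structure H2Pullback {P Q : GaloisMonoidPair.{u}} (φ : P.Hom Q) (T : MonoidKummerTheory P)
    (T' : MonoidKummerTheory Q) : Type u where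
  /-- `H²(φ) : H²(G*, μ_Ẑ(M*)) → H²(G, μ_Ẑ(M))` -/
  map : T'.coh.H2 →+ T.coh.H2
  /-- the index `[G* : φ(G)]` (finite, the image being open) -/
  index : ℕ
  index_pos : 0 < index

/-- **Row P32.i.L07 / Rmk 3.2.2**: «the functoriality of Proposition 3.2, (i), when applied to the
isomorphism `H²(G, μ_Ẑ(M_TM)) ⥲ Ẑ`, is to be understood in the sense of a compatibility, relative to dividing
the `Ẑ` that appears as the codomain of these isomorphisms by a factor given by the index of the image of
the induced open homomorphism on arithmetic Galois groups» — `inv ∘ H²(φ) = [G* : φ(G)] · inv*`.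
Named `Prop` on the data; not asserted. [cite: MochizukiAbsTopIII2015, Remark 3.2.2 p.73] -/
def Prop32i_indexCompat {P Q : GaloisMonoidPair.{u}} {φ : P.Hom Q} {T : MonoidKummerTheory P}
    {T' : MonoidKummerTheory Q} (B : H2Pullback φ T T') : Prop :=
  ∀ x : T'.coh.H2, T.h2Iso (B.map x) = B.index • T'.h2Iso x

/-! ### Prop 3.2 (iv), surjectivity for pairs of strictly Belyi type (plan row P32.iv.L16) -/

/-- **Prop 3.2 (iv), bijectivity clause for STRICTLY BELYI TYPE, `T = TM`** (p. 72 l.19–21: «this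
injection is a bijection if … [`T` is either `TM` or `TF`, and] `(Π ↷ M_T)`, `(Π* ↷ M*_T)` are of strictly
Belyi type»; printed proof p. 72 l.49–50: «The surjectivity portion of assertion (iv) follows from assertion
(iii), when `(Π ↷ M_T)`, `(Π* ↷ M*_T)` are of strictly Belyi type»): every isomorphism of `𝒯𝒢` between the
underlying topological groups of two MLF-Galois `TM`-pairs of strictly Belyi type lifts to an isomorphism of
pairs. Typed as a schema over the hypothesis predicate `IsOfStrictlyBelyiType` (scheme-theoretic origin of
`Π ↠ G`, [AbsTopII] Def 3.5; owner abc-iut-L4-t1/t4, `AbsTopIII.CurveModel.IsStrictlyBelyiType`), exactly as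
`GaloisIsoLiftsToTMPairIso` is typed over `IsOfHypOrbicurveType`. Named `Prop` schema; not asserted.
[cite: MochizukiAbsTopIII2015, Proposition 3.2 (iv) p.72] -/
def GaloisIsoLiftsToTMPairIsoOfStrictlyBelyi (IsOfStrictlyBelyiType : GaloisMonoidPair.{0} → Prop) :
    Prop :=
  ∀ (P Q : GaloisMonoidPair.{0}), IsMLFGaloisMonoidPair .TM P → IsMLFGaloisMonoidPair .TM Q →
    IsOfStrictlyBelyiType P → IsOfStrictlyBelyiType Q →
    ∀ f : P.Pi ≃ₜ* Q.Pi, P.actionKer.map f.toMulEquiv.toMonoidHom = Q.actionKer →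
      ∃ e : GaloisMonoidPair.Iso P Q, e.isoPi = f

/-- **Prop 3.2 (iv), bijectivity clause for STRICTLY BELYI TYPE, `T = TF`** (same printed sentence, the
`TF` case: the pairs are MLF-Galois `TF`-pairs `(Π ↷ k̄)`; by (iii) the topological field structure is
reconstructed functorially). Schema over a hypothesis predicate on `TF`-pairs. Named `Prop` schema; not
asserted. [cite: MochizukiAbsTopIII2015, Proposition 3.2 (iv) p.72] -/
def GaloisIsoLiftsToTFPairIsoOfStrictlyBelyi (IsOfStrictlyBelyiType : GaloisFieldPair.{0} → Prop) :
    Prop :=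
  ∀ (P Q : GaloisFieldPair.{0}), IsMLFGaloisFieldPair P → IsMLFGaloisFieldPair Q →
    IsOfStrictlyBelyiType P → IsOfStrictlyBelyiType Q →
    ∀ f : P.Pi ≃ₜ* Q.Pi, P.actionKer.map f.toMulEquiv.toMonoidHom = Q.actionKer →
      ∃ e : GaloisFieldPair.Iso P Q, e.isoPi = f

/-! ### Prop 3.2 (iv), id-rigidity (plan row P32.iv.L17) -/

/-- The full subcategory of `𝒞^MLF_T` (`MLFGaloisMonoidPairCat T`, Def 3.1 (iii)) cut out by a hypothesis
predicate `H` on pairs — the shape of «`𝒞^{MLF-hyp}_T`» (`H` = of hyperbolic orbicurve type) and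
«`𝒞^{MLF-sB}_T`» (`H` = of strictly Belyi type) of Prop 3.2 (iv) (the predicates themselves are
scheme-theoretic, owner abc-iut-L4-t1). [cite: MochizukiAbsTopIII2015, Proposition 3.2 (iv) p.72] -/
abbrev MLFGaloisMonoidPairSubcat (T : PairType) (H : GaloisMonoidPair.{u} → Prop) : Type (u + 1) :=
  ObjectProperty.FullSubcategory (fun X : MLFGaloisMonoidPairCat.{u} T => H X.obj)

/-- **Prop 3.2 (iv), id-rigidity clause**: «the categories `𝒯𝒢^hyp`, `𝒯𝒢^sB`, …, `𝒞^{MLF-hyp}_T`,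
`𝒞^{MLF-sB}_T`, … are id-rigid [cf. §0]» — here for `𝒞^{MLF-H}_T`, `H` a hypothesis predicate as above, with
§0's «id-rigid» = the tree's `IsIdRigid` (`DiagramMorphisms`: the identity functor has no non-trivial
automorphism). This is the clause CONSUMED (as the hypothesis `IsIdRigid 𝒳`) by the Cor 3.6 (v) / Cor 3.7 (v)
files `AbsTopIII.FrobeniusPictureMLFCores` / `AbsTopIII.BiAnabelianNexusProofs`. Named `Prop` schema; not
asserted. [cite: MochizukiAbsTopIII2015, Proposition 3.2 (iv) p.72] -/
def Prop32iv_idRigid (T : PairType) (H : GaloisMonoidPair.{u} → Prop) : Prop :=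
  IsIdRigid (MLFGaloisMonoidPairSubcat.{u} T H)

/-- **The printed reduction behind the id-rigidity clause** (proof p. 72 l.47–49: centre-freeness «follows
immediately from the slimness of `Π`», and §0: a category all of whose objects have centre-free
automorphism groups, and in which the components of an automorphism of the identity functor are central, is
id-rigid) — in general: if in a category `C` every automorphism of every object that commutes with ALL
automorphisms of that object is the identity, then `C` is id-rigid (the component `α_X` of a natural
automorphism `α` of `𝟭_C` commutes with every automorphism of `X` by naturality). PROVED (elementary).
[cite: MochizukiAbsTopIII2015, Section 0 p.27] -/
theorem isIdRigid_of_aut_center_trivial (C : Type u) [Category.{v} C]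
    (h : ∀ (X : C) (a : X ≅ X), (∀ b : X ≅ X, a ≪≫ b = b ≪≫ a) → a = Iso.refl X) :
    IsIdRigid C := by
  intro α
  ext X
  have hX : α.app X = Iso.refl X := by
    refine h X (α.app X) fun b => ?_
    ext
    simpa using (α.hom.naturality b.hom).symm
  simpa using congrArg Iso.hom hX

end

end Literature.AnabelianGeometry.AbsoluteAnabelian

/-! ## v2 (append-only; abc-iut-w4-d045, 2026-08-26): Prop 3.2 (iv) for `T = TF` (plan rows P32.iv.L13-TF /
L14-TF / L17-TF)

NOTE ON THE PAIR TYPES.  Prop 3.2 opens with «Let `T ∈ {TM, TF}`» (p. 71).  In the tree the `TF`-pairs are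
abc-iut-L4-t2's `GaloisFieldPair` (object the FIELD `k̄`, ring maps), with their own category
`MLFGaloisFieldPairCat` (Def 3.1 (iii)), whereas `ModelMLFGaloisData.monoidPair .TF = none`: the category
`MLFGaloisMonoidPairCat .TF` has NO objects, so `Prop32iv_idRigid .TF H` above holds VACUOUSLY and is NOT the
printed `TF` clause; `Prop32iv_idRigid` is the printed clause at `T = TM` ONLY (at `T ∈ {TLG, TCG}` the category
`𝒞^MLF_T` is NOT id-rigid — inversion `x ↦ x⁻¹` on `M ≅ k̄^×`, `𝒪_k̄^×` is `Π`-equivariant and natural, a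
non-trivial automorphism of the identity functor, cf. Prop 3.3 (ii) «fibers of cardinality two» — and print makes
no id-rigidity claim there).  The printed `TF` clauses of (iv) — injectivity, centre-freeness, id-rigidity — are
typed below over
`MLFGaloisFieldPairCat`, in the shapes of the `TM` typings `PairIsoDeterminedByGalois` / `AutPairCenterFree`
(abc-iut-L4-t2, `MonoidKummerMaps.lean`) and `Prop32iv_idRigid`.  HONEST FRAMING: statements only («typed, not
discharged» unless marked PROVED); nothing here bears on [IUTchIII] Cor 3.12. -/

namespace Literature.AnabelianGeometry.AbsoluteAnabelian

open _root_.CategoryTheory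

universe u

noncomputable section

/-- The full subcategory of `𝒞^MLF_TF` (`MLFGaloisFieldPairCat`, Def 3.1 (iii)) cut out by a hypothesis predicate
`H` on `TF`-pairs — the shape of «`𝒞^{MLF-hyp}_TF`» / «`𝒞^{MLF-sB}_TF`» of Prop 3.2 (iv) (the predicates themselves
are scheme-theoretic, owner abc-iut-L4-t1). [cite: MochizukiAbsTopIII2015, Proposition 3.2 (iv) p.72] -/
abbrev MLFGaloisFieldPairSubcat (H : GaloisFieldPair.{u} → Prop) : Type (u + 1) :=
  ObjectProperty.FullSubcategory (fun X : MLFGaloisFieldPairCat.{u} => H X.obj)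

/-- **Prop 3.2 (iv), id-rigidity clause for `T = TF`**: «the categories … `𝒞^{MLF-hyp}_T`, `𝒞^{MLF-sB}_T`, … are
id-rigid [cf. §0]» at `T = TF` — `IsIdRigid` of the full subcategory `𝒞^{MLF-H}_TF`.  Named `Prop` schema over
the hypothesis predicate `H`; not asserted (PROVED modulo centre-freeness / slimness + `TF` injectivity in the
companion proofs file). [cite: MochizukiAbsTopIII2015, Proposition 3.2 (iv) p.72] -/
def Prop32iv_idRigidTF (H : GaloisFieldPair.{u} → Prop) : Prop :=
  IsIdRigid (MLFGaloisFieldPairSubcat.{u} H)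

/-- **Prop 3.2 (iv), injectivity for `T = TF`**: «the natural functor of Definition 3.1, (iii), induces an
injection `Isom_{𝒞^MLF_T}((Π ↷ M_T), (Π* ↷ M*_T)) ↪ Isom_{𝒯𝒢}(Π, Π*)`» at `T = TF` — an isomorphism of
MLF-Galois `TF`-pairs is determined by its Galois component (the `TF` analogue of `PairIsoDeterminedByGalois`).
Printed route (proof p. 72 l.45–47 with Def 3.1 (iii)): an automorphism of `(Π ↷ k̄)` over `id_Π` preserves the
intrinsically defined `𝒪^⊳ ⊆ k̄`, so is the identity on `𝒪^⊳` by the `TM` case, hence on `k̄ = Frac 𝒪^⊳`.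
Named `Prop` fact (schema); not asserted. [cite: MochizukiAbsTopIII2015, Proposition 3.2 (iv) p.72] -/
def FieldPairIsoDeterminedByGalois : Prop :=
  ∀ (P Q : GaloisFieldPair.{0}), IsMLFGaloisFieldPair P → IsMLFGaloisFieldPair Q →
    ∀ e₁ e₂ : GaloisFieldPair.Iso P Q, e₁.isoPi = e₂.isoPi → e₁.isoM = e₂.isoM

/-- **Prop 3.2 (iv), centre-freeness for `T = TF`**: for `(Π ↷ M_TF)` satisfying the hypothesis predicate `H`
(«of hyperbolic orbicurve type», scheme-theoretic, owner abc-iut-L4-t1), "`Aut_{𝒞^MLF_TF}((Π ↷ M_TF))` … is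
center-free" — a self-isomorphism of the pair commuting with all self-isomorphisms is the identity (the `TF`
analogue of `AutPairCenterFree`).  Named `Prop` schema; not asserted (PROVED from `TF` injectivity + `Z(Π) = 1`
in the companion proofs file). [cite: MochizukiAbsTopIII2015, Proposition 3.2 (iv) p.72] -/
def AutFieldPairCenterFree (H : GaloisFieldPair.{0} → Prop) : Prop :=
  ∀ P : GaloisFieldPair.{0}, IsMLFGaloisFieldPair P → H P →
    ∀ e : GaloisFieldPair.Iso P P,
      (∀ e' : GaloisFieldPair.Iso P P, ∀ x, e.isoM (e'.isoM x) = e'.isoM (e.isoM x)) →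
      (∀ e' : GaloisFieldPair.Iso P P, ∀ g, e.isoPi (e'.isoPi g) = e'.isoPi (e.isoPi g)) →
      (∀ x, e.isoM x = x) ∧ ∀ g, e.isoPi g = g

end

end Literature.AnabelianGeometry.AbsoluteAnabelian
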